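import Mathlib
import Summits.KontsevichZagierPeriods.Zeta5Search.CasSharpness
import Summits.KontsevichZagierPeriods.Zeta5Search.X1CellQSliverWitness
import Summits.KontsevichZagierPeriods.Zeta5Search.CellKitRays
import Summits.KontsevichZagierPeriods.Zeta5Search.ClassDataDecide
import Summits.KontsevichZagierPeriods.Zeta5Search.LemmaDBonusTypes
import Summits.KontsevichZagierPeriods.Zeta5Search.TypeEval
import Summits.KontsevichZagierPeriods.Zeta5Search.TypeSpaceLawZeroFinal
import Summits.KontsevichZagierPeriods.Zeta5Search.UniversalDigitDischarge
import HarnessLib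

/-!
# ζ(5) search — kernel-evaluable mirror of the first-digit determinant and the first EXACT Casoratian valuation of the tree:
# `v₁₇₉(Cas₇(bX1Ray 25)) = −27`, which REFUTES the typed nodes `RayAtlas.X1CellQSliver` and `RayAtlas.X1CellQ`

Cell `pub-zeta5` (HONEST FRAMING: systematic search; no irrationality claim unless certified), designer lineage gen-2, generation 24
(REPORT-gen2-g23 §5 (ii); REPORT-gen2-g24); companion of `CasSharpness` (`casSharpnessT`: `casDigitDet b p j N ≠ 0 ⇒ v_p(Cas_j(b)) = 3 − 2N`).
* §4 (`ClassDecide.*`): kernel-evaluable mirrors of everything entering `casDigitDet` — `gBarD` (`SecondOrder.gBar` on `classExpD`), the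
  type list `levelList` of a class read off by `netExpD`, `cHatL` / `vHatL` (= `cHat_level` / `vHat_level` through `TypeEval.typeRhoC`),
  MEMOISED through a caller-supplied table of type lists (`cHatLook_eq`: the value is table-independent; the table only lets the kernel's
  `whnf` cache evaluate each distinct type once — without it the 52-class instance below exhausts the kernel), `castQ` (`ℚ → ZMod p` as
  `num·den⁻¹`), `casDigitC`; and the bridge **`casDigitDet_eq_casDigitC`** under the decidable side conditions `5 ≤ p ≤ b₀`, no
  depth-`N` class contains the centre.
* §5–§6: the X1-SLIVER WITNESS `(bX1Ray 25, p = 179, e₇)` (gen-2 g23's typed computation node `RayAtlas.SliverWitnessValue`, the smallest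
  prime instance of the sliver `6p < 43n ∧ 7p ≥ 50n` of census g9's Q-cell on the near-miss ray X1): regime H0 (`∀ x, E_x ≥ −15`), a
  depth-`−15` multipole class (`x = 117`) and centre-freeness are kernel decisions on the mirrors; **the digit is decided in the kernel:
  `casDigitC (bX1Ray 25) 179 7 15 x1Tbl ≠ 0` (value `86 ∈ ZMod 179`)**, whence `sliverWitnessValue : SliverWitnessValue`
  (`v₁₇₉(Cas₇) = −27 = casLB`) and, through `X1CellQSliverWitness.not_x1CellQSliver_of_witness / not_x1CellQ_of_witness`, the
  REFUTATIONS `not_x1CellQSliver : ¬ X1CellQSliver`, `not_x1CellQ : ¬ X1CellQ` (the proved part `Atlas.X1CellQMain` / `7p < 50n` is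
  unaffected; the numerics of gen-2 g23 and kit job j140772 agree: `v_p = −27` at `(25,179), (27,193), (32,229), (41,293), (53,379)`).
Standard axioms only (`decide +kernel`, no `native_decide`); ≈ 30 s on the farm.  `p`-adic valuations of rational numbers; NOTHING here
bears on irrationality — records unmoved (0.85488 PROVED / 0.86597135 cond. BZ), certified candidates 0.
-/

noncomputable section

open Finset

/-! ## §4  Computable mirrors of the digit data (`ClassDecide` style) and `casDigitDet = casDigitC`

Everything entering `casDigitDet` has a kernel-evaluable mirror: `ḡ_x` (`SecondOrder.gBar`, with `classExpD`), the level data of a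
centre-free class (`cHat_level`, `vHat_level` with the type read off by `netExpD`, `typeRho = typeRhoC`), `classPoleCountD`, and the cast
`ℚ → ZMod p` as `num · den⁻¹`.  `casDigitDet_eq_casDigitC` rewrites the determinant into the mirror under two decidable side conditions
(`p ≤ b₀`, no deep class contains the centre); an instance is then ONE `decide +kernel`. -/

namespace Summit.KontsevichZagierPeriods.Zeta5Search.ClassDecide

open Summit.KontsevichZagierPeriods.Zeta5Search.ClusterValuation
open Summit.KontsevichZagierPeriods.Zeta5Search.LevelClass (typeRho typeV vHat_level)
open Summit.KontsevichZagierPeriods.Zeta5Search.TypeEval (typeRhoC typeRho_eq_typeRhoC)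
open Literature.NumberTheory.Transcendental.BallRivoal (harm)

/-- Mirror of `SecondOrder.gBar` (`classExp ↦ classExpD`). -/
def gBarD (b : ℕ → ℤ) (p x : ℕ) : ZMod p :=
  2 * (∏ y ∈ (range p).erase (x % p), ((y : ZMod p) - (x : ZMod p)) ^ (max (classExpD b p y) 0).toNat)
    * (∏ y ∈ (range p).erase (x % p), ((y : ZMod p) - (x : ZMod p)) ^ (max (-classExpD b p y) 0).toNat)⁻¹

/-- The kernel-evaluable mirror `gBarD` agrees with `SecondOrder.gBar`. -/
theorem gBarD_eq : gBarD = SecondOrder.gBar := by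
  funext b p x
  simp only [gBarD, SecondOrder.gBar, classExpD_eq]

/-- Level count `L = ⌊(b₀ − x)/p⌋` of the class of a residue `x`. -/
def levelL (b : ℕ → ℤ) (p x : ℕ) : ℕ := ((b 0).toNat - x) / p

/-- The TYPE LIST `[netExp(x), netExp(x+p), …, netExp(x+Lp)]` of the class of `x`, read off by `netExpD`. -/
def levelList (b : ℕ → ℤ) (p x : ℕ) : List ℤ := (List.range (levelL b p x + 1)).map fun k => netExpD b (x + k * p)

/-- Reading entry `k ≤ K` of the list `(range (K+1)).map h` returns `h k`. -/
theorem getD_map_range_int {K k : ℕ} (hk : k ≤ K) (h : ℕ → ℤ) : ((List.range (K + 1)).map h).getD k 0 = h k := by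
  rw [List.getD_eq_getElem?_getD, List.getElem?_map, List.getElem?_range (by omega)]
  rfl

/-- Entry `k` of `levelList b p x` is `netExpD b (x + k·p)` (for `k ≤ levelL b p x`). -/
theorem levelList_getD (b : ℕ → ℤ) (p x : ℕ) {k : ℕ} (hk : k ≤ levelL b p x) :
    (levelList b p x).getD k 0 = netExpD b (x + k * p) :=
  getD_map_range_int hk _

/-- `levelList b p x` has length `levelL b p x + 1`. -/
theorem levelList_length (b : ℕ → ℤ) (p x : ℕ) : (levelList b p x).length = levelL b p x + 1 := by
  simp [levelList]

/-- `ĉ` of a TYPE LIST `T = [e₀,…,e_L]` (`cHat_level` with `typeRhoC`). -/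
def cHatL (L : ℕ) (T : List ℤ) : ℚ :=
  ∑ i ∈ (range (L + 1)).filter (fun i => T.getD i 0 < 0),
    (((i : ℕ) : ℚ) ^ 2 * typeRhoC L (fun k => T.getD k 0) i 1
      + if T.getD i 0 ≤ -2 then 2 * ((i : ℕ) : ℚ) * typeRhoC L (fun k => T.getD k 0) i 2 else 0)

/-- `v̂` of a TYPE LIST (`vHat_level`, `typeV` with `typeRhoC`). -/
def vHatL (L : ℕ) (T : List ℤ) : ℚ :=
  ∑ i ∈ (range (L + 1)).filter (fun i => T.getD i 0 < 0),
    ∑ σ ∈ Icc 1 (-T.getD i 0).toNat, (-1 : ℚ) ^ σ * typeRhoC L (fun k => T.getD k 0) i σ * harm σ i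

/-- MEMOISED `ĉ`: when `T` occurs in the table `tbl`, return the (closed, hence kernel-cached) table term — the VALUE is `cHatL L T`
for every table (`cHatLook_eq`); the table is only a hint that lets `decide +kernel` evaluate each distinct type once. -/
def cHatLook (L : ℕ) (T : List ℤ) : List (List ℤ) → ℚ
  | [] => cHatL L T
  | U :: rest => if T = U then cHatL (U.length - 1) U else cHatLook L T rest

/-- MEMOISED `v̂` (see `cHatLook`). -/
def vHatLook (L : ℕ) (T : List ℤ) : List (List ℤ) → ℚ
  | [] => vHatL L T
  | U :: rest => if T = U then vHatL (U.length - 1) U else vHatLook L T rest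

/-- The memoised `cHatLook` is table-independent: it always returns `cHatL L T`. -/
theorem cHatLook_eq (L : ℕ) (T : List ℤ) (hT : T.length = L + 1) : ∀ tbl, cHatLook L T tbl = cHatL L T
  | [] => rfl
  | U :: rest => by
    unfold cHatLook
    split_ifs with h
    · subst h; simp only [hT, Nat.add_sub_cancel]
    · exact cHatLook_eq L T hT rest

/-- The memoised `vHatLook` is table-independent: it always returns `vHatL L T`. -/
theorem vHatLook_eq (L : ℕ) (T : List ℤ) (hT : T.length = L + 1) : ∀ tbl, vHatLook L T tbl = vHatL L T
  | [] => rfl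
  | U :: rest => by
    unfold vHatLook
    split_ifs with h
    · subst h; simp only [hT, Nat.add_sub_cancel]
    · exact vHatLook_eq L T hT rest

/-- Mirror of `ĉ_x` for a centre-free level class (table-memoised). -/
def cHatC (b : ℕ → ℤ) (p x : ℕ) (tbl : List (List ℤ)) : ℚ := cHatLook (levelL b p x) (levelList b p x) tbl

/-- Mirror of `v̂_x` for a centre-free level class (table-memoised). -/
def vHatC (b : ℕ → ℤ) (p x : ℕ) (tbl : List (List ℤ)) : ℚ := vHatLook (levelL b p x) (levelList b p x) tbl

/-- Mirror of `σ_K(x)`. -/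
def sigmaKC (b : ℕ → ℤ) (p x : ℕ) (tbl : List (List ℤ)) : ℚ := if 2 ≤ classPoleCountD b p x then cHatC b p x tbl else 0

/-- The cast `ℚ → ZMod p` as `num · den⁻¹` (instance-free, kernel-evaluable). -/
def castQ (p : ℕ) (q : ℚ) : ZMod p := ((q.num : ℤ) : ZMod p) * (((q.den : ℕ) : ZMod p))⁻¹

/-- Mirror of `deepClasses`. -/
def deepClassesD (b : ℕ → ℤ) (p N : ℕ) : Finset ℕ := (range p).filter fun x => classExpD b p x = -(N : ℤ)

/-- The kernel-evaluable mirror `deepClassesD` agrees with `deepClasses`. -/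
theorem deepClassesD_eq : deepClassesD = deepClasses := by
  funext b p N
  simp only [deepClassesD, deepClasses, classExpD_eq]

/-- `π̄_j(x) = (b_j − x)(b₀ − b_j − x)` in `ZMod p`. -/
def piC (b : ℕ → ℤ) (p j x : ℕ) : ZMod p := (((b j : ℤ) : ZMod p) - x) * (((b 0 - b j : ℤ) : ZMod p) - x)

/-- **Computable mirror of the first-digit determinant** `casDigitDet` (`tbl` = a memoisation hint: any list of type lists,
ideally the types of the depth-`N` classes; the value does not depend on it, `casDigitDet_eq_casDigitC`). -/
def casDigitC (b : ℕ → ℤ) (p j N : ℕ) (tbl : List (List ℤ)) : ZMod p :=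
  (∑ x ∈ deepClassesD b p N, piC b p j x * (gBarD b p x * castQ p (sigmaKC b p x tbl)))
      * (∑ x ∈ deepClassesD b p N, gBarD b p x * castQ p (vHatC b p x tbl))
    - (∑ x ∈ deepClassesD b p N, gBarD b p x * castQ p (sigmaKC b p x tbl))
      * (∑ x ∈ deepClassesD b p N, piC b p j x * (gBarD b p x * castQ p (vHatC b p x tbl)))

section Bridge

variable {p : ℕ} [hp : Fact p.Prime]

/-- `castQ p q` is the cast of the rational `q` into `ZMod p`. -/
theorem castQ_eq (q : ℚ) : castQ p q = (q : ZMod p) := by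
  rw [castQ, Rat.cast_def, div_eq_mul_inv]

/-- `ĉ_x = cHatC` for a centre-free class of a residue `x < p ≤ b₀`. -/
theorem cHat_eq_cHatC (b : ℕ → ℤ) {x : ℕ} (hx : x < p) (hpb : p ≤ (b 0).toNat) (hc : ¬ CentreIn b p x) (tbl : List (List ℤ)) :
    cHat b p x = cHatC b p x tbl := by
  obtain ⟨hL, hL'⟩ := level_bounds b hp.out.pos (show x ≤ (b 0).toNat by omega)
  rw [cHatC, cHatLook_eq _ _ (levelList_length b p x),
    cHat_level b hx hL hL' (fun k => (levelList b p x).getD k 0)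
      (fun k hk => by show netExp b (x + k * p) = (levelList b p x).getD k 0; rw [levelList_getD b p x hk, netExpD_eq]) hc]
  simp only [cHatL, levelL, typeRho_eq_typeRhoC]

/-- `v̂_x = vHatC` for a centre-free class of a residue `x < p ≤ b₀`. -/
theorem vHat_eq_vHatC (b : ℕ → ℤ) {x : ℕ} (hx : x < p) (hpb : p ≤ (b 0).toNat) (hc : ¬ CentreIn b p x) (tbl : List (List ℤ)) :
    vHat b p x = vHatC b p x tbl := by
  obtain ⟨hL, hL'⟩ := level_bounds b hp.out.pos (show x ≤ (b 0).toNat by omega)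
  have h := vHat_level b hx hL hL' (fun k => (levelList b p x).getD k 0)
    (fun k hk => by show netExp b (x + k * p) = (levelList b p x).getD k 0; rw [levelList_getD b p x hk, netExpD_eq]) hc
  rw [cellA_vHat_eq] at h
  rw [vHatC, vHatLook_eq _ _ (levelList_length b p x), h]
  simp only [vHatL, typeV, levelL, typeRho_eq_typeRhoC]

/-- `σ_K(x) = sigmaKC`. -/
theorem sigmaK_eq_sigmaKC (b : ℕ → ℤ) {x : ℕ} (hx : x < p) (hpb : p ≤ (b 0).toNat) (hc : ¬ CentreIn b p x) (tbl : List (List ℤ)) :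
    sigmaK b p x = sigmaKC b p x tbl := by
  unfold sigmaK sigmaKC
  rw [classPoleCountD_eq, cHat_eq_cHatC b hx hpb hc tbl]

/-- `(ĝ_x : ZMod p) = gBarD` for a residue `x < p`, `p ≥ 5`. -/
theorem cast_gHat_eq_gBarD (b : ℕ → ℤ) (hp5 : 5 ≤ p) {x : ℕ} (hx : x < p) : ((gHat b p x : ℚ) : ZMod p) = gBarD b p x := by
  rw [← ResidueLaw.gBar_eq_cast_gHat b hp5 hx, gBarD_eq]

/-- **`casDigitDet = casDigitC`** whenever `5 ≤ p ≤ b₀` and no depth-`N` class contains the centre. -/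
theorem casDigitDet_eq_casDigitC (b : ℕ → ℤ) (j N : ℕ) (hp5 : 5 ≤ p) (hpb : p ≤ (b 0).toNat)
    (hcen : ∀ x ∈ deepClassesD b p N, ¬ CentreIn b p x) (tbl : List (List ℤ)) :
    casDigitDet b p j N = casDigitC b p j N tbl := by
  have hdata : ∀ x ∈ deepClasses b p N, ((gHat b p x : ℚ) : ZMod p) = gBarD b p x ∧
      ((sigmaK b p x : ℚ) : ZMod p) = castQ p (sigmaKC b p x tbl) ∧ ((vHat b p x : ℚ) : ZMod p) = castQ p (vHatC b p x tbl) := by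
    intro x hx
    have hxp : x < p := by simp only [deepClasses, mem_filter, mem_range] at hx; exact hx.1
    have hc : ¬ CentreIn b p x := hcen x (by rw [deepClassesD_eq]; exact hx)
    exact ⟨cast_gHat_eq_gBarD b hp5 hxp, by rw [castQ_eq, sigmaK_eq_sigmaKC b hxp hpb hc tbl],
      by rw [castQ_eq, vHat_eq_vHatC b hxp hpb hc tbl]⟩
  have hA : (∑ x ∈ deepClasses b p N, ((((b j : ℤ) : ZMod p) - x) * (((b 0 - b j : ℤ) : ZMod p) - x)) *
      (((gHat b p x : ℚ) : ZMod p) * ((sigmaK b p x : ℚ) : ZMod p)))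
      = ∑ x ∈ deepClassesD b p N, piC b p j x * (gBarD b p x * castQ p (sigmaKC b p x tbl)) := by
    rw [deepClassesD_eq]
    exact sum_congr rfl fun x hx => by obtain ⟨h1, h2, -⟩ := hdata x hx; rw [h1, h2, piC]
  have hB : (∑ x ∈ deepClasses b p N, ((gHat b p x : ℚ) : ZMod p) * ((vHat b p x : ℚ) : ZMod p))
      = ∑ x ∈ deepClassesD b p N, gBarD b p x * castQ p (vHatC b p x tbl) := by
    rw [deepClassesD_eq]
    exact sum_congr rfl fun x hx => by obtain ⟨h1, -, h3⟩ := hdata x hx; rw [h1, h3]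
  have hC : (∑ x ∈ deepClasses b p N, ((gHat b p x : ℚ) : ZMod p) * ((sigmaK b p x : ℚ) : ZMod p))
      = ∑ x ∈ deepClassesD b p N, gBarD b p x * castQ p (sigmaKC b p x tbl) := by
    rw [deepClassesD_eq]
    exact sum_congr rfl fun x hx => by obtain ⟨h1, h2, -⟩ := hdata x hx; rw [h1, h2]
  have hE : (∑ x ∈ deepClasses b p N, ((((b j : ℤ) : ZMod p) - x) * (((b 0 - b j : ℤ) : ZMod p) - x)) *
      (((gHat b p x : ℚ) : ZMod p) * ((vHat b p x : ℚ) : ZMod p)))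
      = ∑ x ∈ deepClassesD b p N, piC b p j x * (gBarD b p x * castQ p (vHatC b p x tbl)) := by
    rw [deepClassesD_eq]
    exact sum_congr rfl fun x hx => by obtain ⟨h1, -, h3⟩ := hdata x hx; rw [h1, h3, piC]
  unfold casDigitDet casDigitC
  rw [hA, hB, hC, hE]

end Bridge

end Summit.KontsevichZagierPeriods.Zeta5Search.ClassDecide

namespace Summit.KontsevichZagierPeriods.Zeta5Search.ClusterValuation

/-! ## §5  The X1-sliver witness `(bX1Ray 25, 179, e₇)` reduced to ONE digit of `ZMod 179` -/

section X1Witness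

open Summit.KontsevichZagierPeriods.Zeta5Search.CasoratianValuation (InPolytope shift casoratian)
open Summit.KontsevichZagierPeriods.Zeta5Search.WedgeDictionary (dOf)
open Summit.KontsevichZagierPeriods.Zeta5Search.RayAtlas (bX1Ray SliverWitnessValue X1CellQSliver X1CellQ
  not_x1CellQSliver_of_witness not_x1CellQ_of_witness)
open Summit.KontsevichZagierPeriods.Zeta5Search.CellKit (bLin inPolytope_bLin inPolytope_shift_bLin bX1Ray_eq_bLin)

/-- **Regime H0 at the witness** (kernel decision on the `ClassDecide` mirror, a few seconds): every class exponent of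
`(bX1Ray 25, 179)` is `≥ −15`. -/
theorem x1Witness_expD_ge : ∀ x, x < 179 → -(15 : ℤ) ≤ ClassDecide.classExpD (bX1Ray 25) 179 x := by
  decide +kernel

/-- Regime H0 at the witness, for the tree's `classExp`. -/
theorem x1Witness_exp_ge (x : ℕ) (hx : x < 179) : -(15 : ℤ) ≤ classExp (bX1Ray 25) 179 x := by
  rw [← ClassDecide.classExpD_eq]; exact x1Witness_expD_ge x hx

/-- The depth `−15` is attained by a MULTIPOLE class (`x = 19n − 2p = 117`), so `N = 15` is the multipole minimum and `casLB = −27`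
is the relevant class bound (kernel decision on the mirrors). -/
theorem x1Witness_deep_multipole :
    ClassDecide.classExpD (bX1Ray 25) 179 117 = -15 ∧ 2 ≤ ClassDecide.classPoleCountD (bX1Ray 25) 179 117 := by
  decide +kernel

/-- **The sliver witness is ONE digit.**  `casDigitDet (bX1Ray 25) 179 7 15 ≠ 0 → SliverWitnessValue`
(`v₁₇₉(Cas₇(bX1Ray 25)) = −27`): every other hypothesis of `casSharpnessH0` is discharged here (`InPolytope` of `b` and `b + e₇` from the
linear-ray lemmas, `179 ≤ b₀ = 1525`, `179 ≤ d = 1250`, `1527 < 179²`, regime H0 by `x1Witness_exp_ge`).  The digit itself — a finite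
computation in `ZMod 179` over the 52 deep classes — is decided in §6 below (`x1Witness_digitC_ne_zero`, `x1Witness_digit_ne_zero`). -/
theorem sliverWitnessValue_of_digit [Fact (Nat.Prime 179)] (hdig : casDigitDet (bX1Ray 25) 179 7 15 ≠ 0) : SliverWitnessValue := by
  have hb : InPolytope (bX1Ray 25) := by rw [bX1Ray_eq_bLin]; exact inPolytope_bLin (by norm_num)
  have hb' : InPolytope (shift (bX1Ray 25) 7) := by rw [bX1Ray_eq_bLin]; exact inPolytope_shift_bLin (by norm_num) (by norm_num)
  have hpb : ((179 : ℕ) : ℤ) ≤ bX1Ray 25 0 := by decide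
  have hpd : ((179 : ℕ) : ℤ) ≤ dOf (bX1Ray 25) := by decide
  have hwin : (bX1Ray 25 0 + 2 : ℤ) < ((179 : ℕ) : ℤ) ^ 2 := by decide
  have h := (casSharpnessH0 (p := 179) (bX1Ray 25) 7 15 hb hb' (by norm_num) (by norm_num) (by norm_num) hpb hpd hwin
    (by norm_num) x1Witness_exp_ge hdig).2
  show padicValRat 179 (CasoratianValuation.casoratian (bX1Ray 25) 7) = -27
  rw [h]; norm_num

/-- Hence ONE digit refutes both typed nodes: `casDigitDet (bX1Ray 25) 179 7 15 ≠ 0 → ¬ X1CellQSliver ∧ ¬ X1CellQ`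
(through `X1CellQSliverWitness.not_x1CellQSliver_of_witness` / `not_x1CellQ_of_witness`). -/
theorem not_x1CellQ_of_digit [Fact (Nat.Prime 179)] (hdig : casDigitDet (bX1Ray 25) 179 7 15 ≠ 0) :
    ¬ X1CellQSliver ∧ ¬ X1CellQ :=
  ⟨not_x1CellQSliver_of_witness (sliverWitnessValue_of_digit hdig), not_x1CellQ_of_witness (sliverWitnessValue_of_digit hdig)⟩

/-! ## §6  THE DIGIT, decided in the kernel: `D̄ = 86 ≠ 0` in `ZMod 179`; the sliver witness value and both refutations -/

/-- Memoisation table: the four deep types of the witness (a speed hint only, `casDigitDet_eq_casDigitC` holds for any table). -/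
def x1Tbl : List (List ℤ) :=
  [[1, 1, -5, -6, -6, -2, 1, 1], [1, 1, -2, -6, -6, -5, 1, 1], [1, 1, -4, -6, -6, -3, 1, 1], [1, 1, -3, -6, -6, -4, 1, 1]]

/-- No depth-`15` class of the witness contains the centre (kernel decision on the mirrors). -/
theorem x1Witness_cen : ∀ x ∈ ClassDecide.deepClassesD (bX1Ray 25) 179 15, ¬ CentreIn (bX1Ray 25) 179 x := by
  decide +kernel

set_option maxHeartbeats 8000000 in
/-- **THE FIRST-DIGIT DETERMINANT OF THE WITNESS IS A UNIT** (`= 86` in `ZMod 179`; kernel decision, the 52 deep classes' `ḡ`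
products shared through the `classExpD` cache and the type data evaluated once per type via `x1Tbl`). -/
theorem x1Witness_digitC_ne_zero : ClassDecide.casDigitC (bX1Ray 25) 179 7 15 x1Tbl ≠ 0 := by
  decide +kernel

/-- `casDigitDet (bX1Ray 25) 179 7 15 ≠ 0`. -/
theorem x1Witness_digit_ne_zero [Fact (Nat.Prime 179)] : casDigitDet (bX1Ray 25) 179 7 15 ≠ 0 := by
  rw [ClassDecide.casDigitDet_eq_casDigitC (bX1Ray 25) 7 15 (by norm_num) (by decide) x1Witness_cen x1Tbl]
  exact x1Witness_digitC_ne_zero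

/-- **`SliverWitnessValue` holds**: `v₁₇₉(Cas₇(bX1Ray 25)) = −27` (gen-2 g23's typed computation node, now a theorem). -/
theorem sliverWitnessValue : SliverWitnessValue :=
  haveI : Fact (Nat.Prime 179) := ⟨by norm_num⟩
  sliverWitnessValue_of_digit x1Witness_digit_ne_zero

/-- **REFUTATION of the typed node `X1CellQSliver`** (`v ≥ −26` on the sliver `6p < 43n ∧ 7p ≥ 50n` is FALSE at `(25, 179)`). -/
theorem not_x1CellQSliver : ¬ X1CellQSliver := not_x1CellQSliver_of_witness sliverWitnessValue

/-- **REFUTATION of the typed node `X1CellQ`** (census g9's Q-cell conjunct `v ≥ −26` is FALSE at `(25, 179)`; the proved part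
`X1CellQMain` (`7p < 50n`, `v ≥ −26`) is unaffected). -/
theorem not_x1CellQ : ¬ X1CellQ := not_x1CellQ_of_witness sliverWitnessValue

end X1Witness

end Summit.KontsevichZagierPeriods.Zeta5Search.ClusterValuation

end
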